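import Literature.AlgebraicGeometry.Resolution.ValuationConjugation
import Literature.AlgebraicGeometry.Resolution.DefectTransport
import Literature.AlgebraicGeometry.Resolution.ValuationRingsAlgebraicExtension
import Literature.AlgebraicGeometry.Resolution.TranscendentallyImmediate
import Mathlib.FieldTheory.PrimitiveElement
import Mathlib.FieldTheory.SeparableClosure
import Mathlib.FieldTheory.PurelyInseparable.PerfectClosure
import Mathlib.FieldTheory.Minpoly.IsIntegrallyClosed
import Mathlib.Algebra.Algebra.Tower
import HarnessLib

/-!
# Finite extensions of a defectless valued field with `e = 1` and separable residue field extension, I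

Topic: `Literature/AlgebraicGeometry/Resolution` (valued function fields). PROVED classical
valuation theory, first half of the proof of the theorem
`exists_generator_valuation_derivative_eq_one` (`UnramifiedDefectlessGenerator.lean`): a finite
extension `K|F` of valued fields with `(F, O ∩ F)` a defectless (= stable) field, `|F^×| = |K^×|`
and `κ(O)` separable over `κ(O ∩ F)` is *unramified*, i.e. `O` is local-standard-étale over
`O ∩ F` — there is `η ∈ O` with `K = F(η)`, `minpoly_F(η) ∈ (O ∩ F)[X]` and `|minpoly_F(η)'(η)| = 1`.
This is the valuation theory behind M. Temkin, *Inseparable local uniformization*, J. Algebra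
373 (2013) 65–119 = arXiv:0804.1554v3, proof of Thm. 5.5.1 (iii), p. 59: "the extension
`K/K_B` is unramified because `K_B` is stable by Remark 2.1.3, `|K_B^×| = |K^×|` and `K̃` is
separable over `k(B̃_F) = K̃_B` … and `K°` is étale over `K°_B`" (the named fact
`Temkin2013_Thm551iii_inertial`, `AbhyankarToroidalChartsEtale.lean`; assembled from the
generalized stability theorem in `AbhyankarToroidalChartsInertial.lean`). The classical route
(henselization, `[L : K] = ∑ e f d` over the henselian factors, inertia fields, [Raynaud 1970,
Ch. X Thm. 1]) is replaced by an elementary Galois-theoretic argument, for which this file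
supplies:

* `ramificationIndex_mul_inertiaDegree_eq_card_stabilizer` — **`e f = |D|`**: for `N|K` finite
  Galois and `K ∩ A` defectless in `N`, the extensions of `K ∩ A` are the `[G : D]` conjugates of
  `A` (conjugation theorem, `ValuationConjugation.lean`), all with the same `e, f`
  (`DefectTransport.lean`), so `∑ e f = [N : K] = |G|` gives `e(A/K) f(A/K) = |D|`, `D` the
  decomposition group (stabilizer) of `A`.
* `ramificationIndex_mul_inertiaDegree_mul_card_inf` — in a tower `F ⊆ K ⊆ N`, `N|F` finite
  Galois, `F` a defectless field: `e(A ∩ K/F) f(A ∩ K/F) |D ∩ Gal(N|K)| = |D|` (the above over `F`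
  and over `K` — finite extensions of defectless fields are defectless,
  `IsDefectlessField.finiteDimensional` — and the multiplicativity of `e`, `f`,
  `GeneralizedStability.lean`).
* `residueSubfield_eq_top_of_isPurelyInseparable` — **`f = 1`**: in a purely inseparable extension
  every residue of `O` is purely inseparable over `Ẽ`, so a separable residue field extension is
  trivial (uniqueness of the extension of the valuation ring itself is
  `valuationSubring_eq_of_comap_eq_of_isPurelyInseparable`,
  `InseparableLocalUniformizationDescent.lean`).
* `isSeparable_of_isDefectlessField` — **separability**: with `S` the separable closure of `F` in
  `K`, `O` is the only extension of `O ∩ S`, with `e = f = 1`, so `[K : S] = e f = 1` by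
  defectlessness of `S`.
* `exists_unit_generator_mem_maximalIdeal` — **the generator `η`**: a unit of `O`, integral over
  `O ∩ F`, whose residue is a (non-zero) primitive element of `κ(O)/κ(O ∩ F)` and which lies in the
  maximal ideal of every other extension of `O ∩ F` to `K` (Chinese remainder theorem in the
  integral closure `C` of `O ∩ F`, whose maximal ideals are the distinct centres of the finitely
  many extensions, `ValuationRingsAlgebraicExtension.lean`); `minpoly_F(η) ∈ (O ∩ F)[X]` as
  `O ∩ F` is integrally closed.
* `adjoin_simple_eq_top_of_isDefectlessField` — **`K = F(η)`**: `O` is the only extension of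
  `O ∩ F(η)`, with `e = f = 1`, and `F(η)` is a defectless field, so `[K : F(η)] = 1`.

## Sources

* M. Temkin, *Inseparable local uniformization*, J. Algebra 373 (2013) = arXiv:0804.1554v3,
  §2.1 (p. 9: `e`, `f`, defectless, stable; Remark 2.1.1: extensions of the valuation ↔ maximal
  ideals of the integral closure) and the proof of Thm. 5.5.1 (iii) (p. 59).
* F.-V. Kuhlmann, *Elimination of ramification I: The generalized stability theorem*, Trans.
  AMS 362 (2010) = arXiv:1003.5678, §§1–2 (fundamental inequality, defectless fields, Cor. 2.16).
* N. Bourbaki, *Algèbre commutative* VI §8 no. 6 (conjugation theorem, valuation rings of an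
  algebraic extension), as proved in the tree.

## Rendering notes

* As in `ValuationDefect.lean`: an extension of valued fields is `[Algebra F K]` plus
  `O : ValuationSubring K`, with `O ∩ F = O.comap (algebraMap F K)`; `|F^×| = |K^×|` is
  `valueSubgroup F O = ⊤`; "`κ(O)` separable over `κ(O ∩ F)`" is separability of every element of
  `ResidueField O` over the subfield `residueSubfield F O`.
* Lemmas about subfields of a residue field are stated for a generic field and instantiated: a
  concrete `rfl` between ring maps out of subfields of `ResidueField O` is too expensive for the
  kernel.
-/

noncomputable section

open scoped Pointwise IntermediateField
open IsLocalRing Polynomial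

namespace Literature.AlgebraicGeometry.Resolution

universe u

/-! ### Conjugates of a valuation ring: `σ • A` -/

section SmulComap

variable {K N : Type u} [Field K] [Field N] [Algebra K N]

/-- `σ • A = σ(A)` is the preimage of `A` under `σ⁻¹`. [folklore] -/
theorem pointwise_smul_eq_comap_symm (σ : N ≃ₐ[K] N) (A : ValuationSubring N) :
    σ • A = A.comap ((σ.symm : N ≃ₐ[K] N) : N →+* N) := by
  ext x
  rw [ValuationSubring.mem_pointwise_smul_iff_inv_smul_mem, ValuationSubring.mem_comap]
  rfl

/-- `e(σ(A)/K) = e(A/K)`. [folklore] -/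
theorem ramificationIndex_smul (σ : N ≃ₐ[K] N) (A : ValuationSubring N) :
    ramificationIndex K (σ • A) = ramificationIndex K A := by
  rw [pointwise_smul_eq_comap_symm]
  exact ramificationIndex_comap_algEquiv K A σ.symm

/-- `f(σ(A)/K) = f(A/K)`. [folklore] -/
theorem inertiaDegree_smul (σ : N ≃ₐ[K] N) (A : ValuationSubring N) :
    inertiaDegree K (σ • A) = inertiaDegree K A := by
  rw [pointwise_smul_eq_comap_symm]
  exact inertiaDegree_comap_algEquiv K A σ.symm

/-- The valuation of `σ • A` is `v_A ∘ σ⁻¹`: `|x|_{σA} < 1 ↔ |σ⁻¹ x|_A < 1`. [folklore] -/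
theorem valuation_smul_lt_one_iff' (σ : N ≃ₐ[K] N) (A : ValuationSubring N) (x : N) :
    (σ • A).valuation x < 1 ↔ A.valuation (σ.symm x) < 1 :=
  valuation_smul_lt_one_iff σ A x

/-- Restricting scalars does not change the conjugate: `(τ|_F) • A = τ • A`. [folklore] -/
theorem restrictScalars_smul {F : Type u} [Field F] [Algebra F K] [Algebra F N] [IsScalarTower F K N]
    (τ : N ≃ₐ[K] N) (A : ValuationSubring N) : (τ.restrictScalars F) • A = τ • A := by
  ext x
  rw [pointwise_smul_eq_comap_symm, pointwise_smul_eq_comap_symm, ValuationSubring.mem_comap,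
    ValuationSubring.mem_comap]
  rfl

end SmulComap

/-! ### Extensions of a valuation in a finite Galois extension: `e f = |D|` when defectless -/

section Galois

variable (K : Type u) {N : Type u} [Field K] [Field N] [Algebra K N] [FiniteDimensional K N]
  [IsGalois K N]

/-- In a finite Galois extension `N|K`, the valuation rings of `N` inducing `A ∩ K` on `K` are
exactly the conjugates `σ • A` (conjugation theorem). [folklore] -/
theorem comap_eq_comap_iff_mem_orbit (A W : ValuationSubring N) :
    W.comap (algebraMap K N) = A.comap (algebraMap K N) ↔ W ∈ MulAction.orbit (N ≃ₐ[K] N) A := by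
  constructor
  · intro h
    obtain ⟨σ, hσ⟩ := exists_smul_eq_of_finiteDimensional K A W h.symm
    exact MulAction.mem_orbit_iff.mpr ⟨σ, hσ⟩
  · intro h
    obtain ⟨σ, rfl⟩ := MulAction.mem_orbit_iff.mp h
    exact comap_smul_algEquiv σ A

/-- **`e · f = |D|` for a defectless Galois extension.** If `N|K` is finite Galois and `K ∩ A`
is defectless in `N` (`∑ e f = [N : K]` over the extensions, which are the `[G : D]` conjugates
of `A`, all with the same `e`, `f`), then `e(A/K) f(A/K)` is the order of the decomposition
group `D = {σ | σ • A = A}`. [folklore] -/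
theorem ramificationIndex_mul_inertiaDegree_eq_card_stabilizer (A : ValuationSubring N)
    (hdef : IsDefectlessIn K (A.comap (algebraMap K N)) N) :
    ramificationIndex K A * inertiaDegree K A =
      Nat.card (MulAction.stabilizer (N ≃ₐ[K] N) A) := by
  classical
  obtain ⟨s, hs, hsum⟩ := hdef
  have hconst : ∀ W ∈ s, ramificationIndex K W * inertiaDegree K W =
      ramificationIndex K A * inertiaDegree K A := by
    intro W hW
    obtain ⟨σ, rfl⟩ := MulAction.mem_orbit_iff.mp
      ((comap_eq_comap_iff_mem_orbit K A W).mp ((hs W).mp hW))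
    rw [ramificationIndex_smul, inertiaDegree_smul]
  rw [Finset.sum_eq_card_nsmul hconst, smul_eq_mul] at hsum
  have hcard : s.card = (MulAction.stabilizer (N ≃ₐ[K] N) A).index := by
    rw [MulAction.index_stabilizer, ← Set.ncard_coe_finset]
    congr 1
    ext W
    rw [Finset.mem_coe, hs, comap_eq_comap_iff_mem_orbit]
  rw [hcard, ← IsGalois.card_aut_eq_finrank K N,
    ← Subgroup.index_mul_card (MulAction.stabilizer (N ≃ₐ[K] N) A)] at hsum
  exact Nat.eq_of_mul_eq_mul_left (Nat.pos_of_ne_zero Subgroup.index_ne_zero_of_finite) hsum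

end Galois

/-! ### The tower `F ⊆ K ⊆ N`: `e(A ∩ K/F) f(A ∩ K/F) = [D : D ∩ Gal(N|K)]` -/

section Tower

variable (F K : Type u) {N : Type u} [Field F] [Field K] [Field N] [Algebra F K] [Algebra F N]
  [Algebra K N] [IsScalarTower F K N] [FiniteDimensional F N] [IsGalois F N]

omit [FiniteDimensional F N] [IsGalois F N] in
/-- The stabilizer of `A` in `Gal(N|K)` is in bijection with `D ∩ Gal(N|K)` inside `Gal(N|F)`,
`D` the stabilizer of `A` in `Gal(N|F)`. [folklore] -/
theorem card_stabilizer_eq_card_inf (A : ValuationSubring N) :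
    Nat.card (MulAction.stabilizer (N ≃ₐ[K] N) A) =
      Nat.card ↥(MulAction.stabilizer (N ≃ₐ[F] N) A ⊓
        (AlgEquiv.restrictScalarsHom F : (N ≃ₐ[K] N) →* (N ≃ₐ[F] N)).range) := by
  refine Nat.card_congr (Equiv.ofBijective
    (fun τ => ⟨AlgEquiv.restrictScalarsHom F τ.1, ?_, ?_⟩) ⟨?_, ?_⟩)
  · show (AlgEquiv.restrictScalarsHom F τ.1) • A = A
    rw [AlgEquiv.restrictScalarsHom_apply, restrictScalars_smul]
    exact τ.2
  · exact ⟨τ.1, rfl⟩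
  · intro τ₁ τ₂ h
    exact Subtype.ext (AlgEquiv.restrictScalarsHom_injective F (congrArg Subtype.val h))
  · rintro ⟨g, hgD, τ, rfl⟩
    refine ⟨⟨τ, ?_⟩, rfl⟩
    show τ • A = A
    rw [← restrictScalars_smul (F := F)]
    exact hgD

variable [FiniteDimensional K N] [IsGalois K N] [FiniteDimensional F K]

/-- **`e(A ∩ K/F) · f(A ∩ K/F) · |D ∩ Gal(N|K)| = |D|`** for `F ⊆ K ⊆ N`, `N|F` finite Galois,
when `F` is a defectless field at `A ∩ F` (then `F` is defectless in `N` and the finite extension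
`K` is defectless in `N`; combine `e f = |D|` over `F` and over `K` with the multiplicativity of
`e` and `f`). [folklore] -/
theorem ramificationIndex_mul_inertiaDegree_mul_card_inf (A : ValuationSubring N)
    (hdef : IsDefectlessField F (A.comap (algebraMap F N))) :
    ramificationIndex F (A.comap (algebraMap K N)) * inertiaDegree F (A.comap (algebraMap K N)) *
      Nat.card ↥(MulAction.stabilizer (N ≃ₐ[F] N) A ⊓
        (AlgEquiv.restrictScalarsHom F : (N ≃ₐ[K] N) →* (N ≃ₐ[F] N)).range) =
      Nat.card (MulAction.stabilizer (N ≃ₐ[F] N) A) := by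
  have hKF : (A.comap (algebraMap K N)).comap (algebraMap F K) = A.comap (algebraMap F N) := by
    rw [ValuationSubring.comap_comap, ← IsScalarTower.algebraMap_eq]
  -- `K` is a defectless field at `A ∩ K`, hence defectless in `N`; `F` is defectless in `N`
  have hdefK : IsDefectlessField K (A.comap (algebraMap K N)) :=
    IsDefectlessField.finiteDimensional (K := F) (A.comap (algebraMap K N)) (by rw [hKF]; exact hdef)
  have hF := ramificationIndex_mul_inertiaDegree_eq_card_stabilizer F A (hdef N inferInstance)
  have hK := ramificationIndex_mul_inertiaDegree_eq_card_stabilizer K A (hdefK N inferInstance)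
  rw [← hF, ← card_stabilizer_eq_card_inf F K A, ← hK, ramificationIndex_tower F K A,
    inertiaDegree_tower F K A]
  ring

end Tower

/-! ### Purely inseparable extensions: `e = f = 1` (uniqueness of the extension:
`valuationSubring_eq_of_comap_eq_of_isPurelyInseparable`) -/

section PurelyInseparable

variable {E K : Type u} [Field E] [Field K] [Algebra E K]

/-- `|F^×| ⊆ |E^×|` inside `|K^×|` for a tower `F → E → K`. [folklore] -/
theorem valueSubgroup_le_valueSubgroup (F : Type u) [Field F] [Algebra F E] [Algebra F K]
    [IsScalarTower F E K] (O : ValuationSubring K) : valueSubgroup F O ≤ valueSubgroup E O := by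
  intro γ hγ
  obtain ⟨c, hc0, hγc⟩ := (mem_valueSubgroup_iff F O γ).mp hγ
  refine (mem_valueSubgroup_iff E O γ).mpr ⟨algebraMap F E c, (_root_.map_ne_zero _).mpr hc0, ?_⟩
  rw [hγc, IsScalarTower.algebraMap_apply F E K]

/-- `e(O/E) = 1` as soon as `|F^×| = |K^×|` for a smaller field `F → E → K`. [folklore] -/
theorem ramificationIndex_eq_one_of_valueSubgroup_eq_top (F : Type u) [Field F] [Algebra F E]
    [Algebra F K] [IsScalarTower F E K] (O : ValuationSubring K) (hE : valueSubgroup F O = ⊤) :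
    ramificationIndex E O = 1 := by
  unfold ramificationIndex
  rw [Subgroup.index_eq_one, eq_top_iff, ← hE]
  exact valueSubgroup_le_valueSubgroup F O

/-- The residue field of a valuation ring of a field of prime characteristic `p` has
characteristic `p`. [folklore] -/
theorem charP_residueField (O : ValuationSubring K) (p : ℕ) [Fact p.Prime] [CharP K p] :
    CharP (ResidueField O) p := by
  have hO : (p : O) = 0 := Subtype.ext (by simp)
  have h0 : (p : ResidueField O) = 0 := by
    rw [← map_natCast (algebraMap O (ResidueField O)), hO, map_zero]
  exact (CharP.charP_iff_prime_eq_zero Fact.out).mpr h0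

variable (E) [IsPurelyInseparable E K]

/-- **`f(O/E) = 1` in a purely inseparable extension with separable residue field extension**:
every residue of `O` is separable over `Ẽ` and purely inseparable over it (`z^{q^n} ∈ E`),
hence lies in `Ẽ`. [folklore] -/
theorem residueSubfield_eq_top_of_isPurelyInseparable (O : ValuationSubring K)
    (hsep : ∀ r : ResidueField O, IsSeparable (residueSubfield E O) r) :
    residueSubfield E O = ⊤ := by
  set R := residueSubfield E O with hR
  obtain ⟨q, hq⟩ := ExpChar.exists E
  refine eq_top_iff.mpr fun r _ => ?_
  obtain ⟨z, rfl⟩ := residue_surjective r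
  obtain ⟨n, y, hy⟩ := IsPurelyInseparable.pow_mem E q (z : K)
  -- `residue z ^ (q ^ n)` is the residue of an element of `E`
  have hyO : algebraMap E K y ∈ O := by
    rw [hy]
    exact pow_mem z.2 _
  have hpow : residue O z ^ q ^ n ∈ R := by
    have : residue O z ^ q ^ n = residue O ⟨algebraMap E K y, hyO⟩ := by
      rw [← map_pow]
      exact congrArg (residue O) (Subtype.ext hy.symm)
    rw [this]
    exact residue_mem_residueSubfield E O y hyO
  rcases hq with _ | ⟨hprime⟩
  · -- `q = 1`
    simpa using hpow
  · haveI : Fact q.Prime := ⟨hprime⟩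
    haveI : CharP K q := charP_of_injective_algebraMap (algebraMap E K).injective q
    haveI : CharP (ResidueField O) q := charP_residueField O q
    haveI : ExpChar (ResidueField O) q := ExpChar.prime hprime
    haveI : ExpChar R q :=
      (algebraMap R (ResidueField O)).expChar (algebraMap R (ResidueField O)).injective q
    have hperf : residue O z ∈ perfectClosure R (ResidueField O) :=
      (mem_perfectClosure_iff_pow_mem q).mpr ⟨n, ⟨residue O z ^ q ^ n, hpow⟩, rfl⟩
    have hsepc : residue O z ∈ separableClosure R (ResidueField O) :=
      mem_separableClosure_iff.mpr (hsep _)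
    have hbot : residue O z ∈ (⊥ : IntermediateField R (ResidueField O)) := by
      rw [← separableClosure_inf_perfectClosure]
      exact ⟨hsepc, hperf⟩
    obtain ⟨r₀, hr₀⟩ := IntermediateField.mem_bot.mp hbot
    rw [← hr₀]
    exact r₀.2

end PurelyInseparable

/-! ### A defectless extension with `e = 1` and separable residue field extension is separable -/

section SeparableOfDefectless

variable {F K : Type u} [Field F] [Field K] [Algebra F K] (O : ValuationSubring K)

/-- Residues separable over `F̃` are separable over `Ẽ ⊇ F̃` for `F → E → K`. [folklore] -/
theorem isSeparable_residueSubfield_tower (E : Type u) [Field E] [Algebra F E] [Algebra E K]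
    [IsScalarTower F E K] (hsep : ∀ r : ResidueField O, IsSeparable (residueSubfield F O) r)
    (r : ResidueField O) : IsSeparable (residueSubfield E O) r :=
  isSeparable_of_subfield_le (residueSubfield_le_residueSubfield F E O) (hsep r)

/-- `[κ : ⊤] = 1` for the top subfield of a field `κ`. [folklore] -/
theorem finrank_top_subfield_eq_one (κ : Type u) [Field κ] :
    Module.finrank (⊤ : Subfield κ) κ = 1 := by
  have h := Algebra.finrank_eq_of_equiv_equiv (Subfield.topEquiv : (⊤ : Subfield κ) ≃+* κ)
    (RingEquiv.refl κ) (by ext; rfl)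
  rw [h, Module.finrank_self]

variable [FiniteDimensional F K]

/-- **Separability from defectlessness.** Let `K|F` be finite, `O` a valuation ring of `K` such
that `(F, O ∩ F)` is a defectless field, `|F^×| = |K^×|` and the residue field of `O` is
separable over that of `O ∩ F`. Then `K|F` is separable: the separable closure `S` of `F` in `K`
is a defectless field, `O` is the only extension of `O ∩ S` to the purely inseparable `K|S`,
with `e = f = 1`, so `[K : S] = e f = 1`. [folklore] -/
theorem isSeparable_of_isDefectlessField (hdef : IsDefectlessField F (O.comap (algebraMap F K)))
    (hE : valueSubgroup F O = ⊤)
    (hsep : ∀ r : ResidueField O, IsSeparable (residueSubfield F O) r) :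
    Algebra.IsSeparable F K := by
  classical
  set S := separableClosure F K with hS
  set OS := O.comap (algebraMap S K) with hOS
  have hSF : OS.comap (algebraMap F S) = O.comap (algebraMap F K) := by
    rw [hOS, ValuationSubring.comap_comap, ← IsScalarTower.algebraMap_eq]
  have hdefS : IsDefectlessField S OS :=
    IsDefectlessField.finiteDimensional (K := F) OS (by rw [hSF]; exact hdef)
  obtain ⟨s, hs, hsum⟩ := hdefS K inferInstance
  -- `O` is the only extension of `OS` to `K`
  have hsO : s = {O} := by
    ext W
    rw [hs, Finset.mem_singleton]
    constructor
    · intro h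
      exact valuationSubring_eq_of_comap_eq_of_isPurelyInseparable (h.trans hOS)
    · rintro rfl
      rw [hOS]
  have hf : inertiaDegree S O = 1 := by
    unfold inertiaDegree
    rw [residueSubfield_eq_top_of_isPurelyInseparable S O
      (isSeparable_residueSubfield_tower O S hsep)]
    exact finrank_top_subfield_eq_one _
  rw [hsO, Finset.sum_singleton, ramificationIndex_eq_one_of_valueSubgroup_eq_top F O hE, hf,
    mul_one] at hsum
  -- `[K : S] = 1`, so `S = ⊤`
  have htop : S = ⊤ := by
    refine IntermediateField.eq_of_le_of_finrank_eq' le_top ?_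
    rw [← hsum, IntermediateField.finrank_top]
  exact (separableClosure.eq_top_iff F K).mp htop

end SeparableOfDefectless

/-! ### The generator `η`: a unit of `O`, in the maximal ideal of the other extensions -/

section Generator

variable {F K : Type u} [Field F] [Field K] [Algebra F K] [FiniteDimensional F K]
  (O : ValuationSubring K)

/-- A primitive element of a finite separable extension can be taken non-zero. [folklore] -/
theorem exists_primitive_element_ne_zero (R : Type u) {κ : Type u} [Field R] [Field κ] [Algebra R κ]
    [FiniteDimensional R κ] [Algebra.IsSeparable R κ] :
    ∃ a : κ, IntermediateField.adjoin R {a} = ⊤ ∧ a ≠ 0 := by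
  obtain ⟨a, ha⟩ := Field.exists_primitive_element R κ
  by_cases h0 : a = 0
  · refine ⟨1, ?_, one_ne_zero⟩
    rw [h0, IntermediateField.adjoin_zero] at ha
    rw [IntermediateField.adjoin_one]
    exact ha
  · exact ⟨a, ha, h0⟩

/-- **The generator.** Let `K|F` be finite, `O` a valuation ring of `K` with `(F, O ∩ F)` a
defectless field and the residue field `κ(O)` separable over `κ(O ∩ F)`. Then there is `η ∈ K`,
integral over `O ∩ F` (its minimal polynomial over `F` has coefficients in `O ∩ F`), which is a
unit of `O` whose residue generates `κ(O)` over `κ(O ∩ F)`, and which lies in the maximal ideal of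
every other extension of `O ∩ F` to `K` (Chinese remainder theorem in the integral closure of
`O ∩ F`, whose maximal ideals are the centres of the finitely many extensions). [folklore] -/
theorem exists_unit_generator_mem_maximalIdeal
    (hdef : IsDefectlessField F (O.comap (algebraMap F K)))
    (hsep : ∀ r : ResidueField O, IsSeparable (residueSubfield F O) r) :
    ∃ (η : K) (hη : η ∈ O), O.valuation η = 1 ∧
      IntermediateField.adjoin (residueSubfield F O) {residue O ⟨η, hη⟩} = ⊤ ∧
      (∀ i, (minpoly F η).coeff i ∈ O.comap (algebraMap F K)) ∧
      ∀ W : ValuationSubring K, W.comap (algebraMap F K) = O.comap (algebraMap F K) → W ≠ O →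
        W.valuation η < 1 := by
  classical
  set R := residueSubfield F O with hR
  haveI : Module.Finite R (ResidueField O) := (ramificationIndex_mul_inertiaDegree_le_finrank F O).2.1
  haveI : Algebra.IsSeparable R (ResidueField O) := ⟨hsep⟩
  obtain ⟨ab, habtop, hab0⟩ := exists_primitive_element_ne_zero R (κ := ResidueField O)
  obtain ⟨α, hα⟩ := residue_surjective ab
  -- the extensions of `A = O ∩ F` to `K`
  set A := O.comap (algebraMap F K) with hA
  obtain ⟨s, hs, -⟩ := hdef K inferInstance
  have hO : O ∈ s := (hs O).mpr rfl
  letI : Algebra A K := ((algebraMap F K).comp (algebraMap A F)).toAlgebra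
  haveI : IsScalarTower A F K := IsScalarTower.of_algebraMap_eq fun _ => rfl
  have hAW : ∀ W ∈ s, A ≤ W.comap (algebraMap F K) := fun W hW => ((hs W).mp hW).ge
  -- the centres of the extensions on the integral closure `C` of `A` in `K`
  set C := integralClosure A K with hC
  let 𝔫 : ↥s → Ideal C := fun W => (maximalIdeal W.1).comap
    ((algebraMap C K).codRestrict W.1 (coe_integralClosure_mem (hAW W.1 W.2)))
  have hmem𝔫 : ∀ (W : ↥s) (b : C), b ∈ 𝔫 W ↔ W.1.valuation b < 1 := fun W b =>
    mem_comap_maximalIdeal_iff (hAW W.1 W.2) b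
  have hprime : ∀ W : ↥s, (𝔫 W).IsPrime := fun W => Ideal.IsPrime.comap _
  have hmax : ∀ W : ↥s, (𝔫 W).IsMaximal := by
    intro W
    haveI := hprime W
    refine Ideal.isMaximal_of_isIntegral_of_isMaximal_comap (R := A) (𝔫 W) ?_
    suffices h : (𝔫 W).comap (algebraMap A C) = maximalIdeal A by rw [h]; infer_instance
    ext a
    rw [Ideal.mem_comap, hmem𝔫, ValuationSubring.valuation_lt_one_iff]
    have h1 : ((algebraMap A C a : C) : K) = algebraMap F K a := rfl
    rw [h1]
    exact valuation_algebraMap_lt_one_iff_of_comap_eq ((hs W.1).mp W.2) a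
  have hne𝔫 : ∀ W₁ W₂ : ↥s, W₁ ≠ W₂ → 𝔫 W₁ ≠ 𝔫 W₂ := by
    intro W₁ W₂ hne h
    apply hne
    apply Subtype.ext
    refine eq_of_forall_valuation_coe_eq_one_iff (hAW W₁.1 W₁.2) (hAW W₂.1 W₂.2) fun b => ?_
    rw [valuation_coe_eq_one_iff (hAW W₁.1 W₁.2), valuation_coe_eq_one_iff (hAW W₂.1 W₂.2),
      ← hmem𝔫, ← hmem𝔫, h]
  have hcop : Pairwise (Function.onFun IsCoprime 𝔫) := by
    intro W₁ W₂ hne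
    haveI := hmax W₁
    haveI := hmax W₂
    exact Ideal.isCoprime_of_isMaximal (hne𝔫 W₁ W₂ hne)
  -- an element `c ∈ C` with residue `ab` at `O`
  obtain ⟨s₀, hs₀1, hs₀α⟩ := (mem_iff_exists_mul_mem (hAW O hO) (α : K)).mp α.2
  have hs₀𝔫 : s₀ ∉ 𝔫 ⟨O, hO⟩ := by
    rw [hmem𝔫, hs₀1]
    exact lt_irrefl 1
  obtain ⟨t, i, hi, hti⟩ := (hmax ⟨O, hO⟩).exists_inv hs₀𝔫
  set c : C := t * ⟨(s₀ : K) * α, hs₀α⟩ with hc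
  have hcα : O.valuation ((c : K) - α) < 1 := by
    -- `c - α = α (t s₀ - 1) = -α i`
    have hi' : O.valuation (i : K) < 1 := (hmem𝔫 ⟨O, hO⟩ i).mp hi
    have heq : (c : K) - α = -((α : K) * i) := by
      have h1 : ((t * s₀ + i : C) : K) = 1 := by rw [hti]; rfl
      have h2 : (t : K) * s₀ = 1 - i := by
        have : ((t * s₀ + i : C) : K) = (t : K) * s₀ + i := rfl
        rw [this] at h1
        linear_combination h1
      show (t : K) * (s₀ * α) - α = -((α : K) * i)
      linear_combination (α : K) * h2
    rw [heq, Valuation.map_neg, map_mul]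
    calc O.valuation (α : K) * O.valuation (i : K) ≤ 1 * O.valuation (i : K) := by
          gcongr; exact (O.valuation_le_one_iff _).mpr α.2
      _ < 1 := by rw [one_mul]; exact hi'
  -- Chinese remainder: `r ≡ c` at `O`, `r ∈ 𝔫 W` at the other extensions
  obtain ⟨r, hr⟩ := Ideal.pi_quotient_surjective hcop
    (fun W => if W = ⟨O, hO⟩ then Ideal.Quotient.mk (𝔫 W) c else 0)
  have hrO : r - c ∈ 𝔫 ⟨O, hO⟩ := by
    have := hr ⟨O, hO⟩
    rw [if_pos rfl] at this
    exact Ideal.Quotient.eq.mp this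
  have hrW : ∀ W : ↥s, W ≠ ⟨O, hO⟩ → r ∈ 𝔫 W := by
    intro W hW
    have := hr W
    rw [if_neg hW] at this
    exact Ideal.Quotient.eq_zero_iff_mem.mp this
  -- `η := r`
  have hrmemO : (r : K) ∈ O := coe_integralClosure_mem (hAW O hO) r
  have hrα : O.valuation ((r : K) - α) < 1 := by
    have h1 : O.valuation ((r : K) - c) < 1 := (hmem𝔫 ⟨O, hO⟩ (r - c)).mp hrO
    have : (r : K) - α = ((r : K) - c) + ((c : K) - α) := by ring
    rw [this]
    exact Valuation.map_add_lt _ h1 hcα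
  have hres : residue O ⟨(r : K), hrmemO⟩ = ab := by
    rw [← hα, ← sub_eq_zero, ← map_sub, residue_eq_zero_iff, ValuationSubring.valuation_lt_one_iff]
    exact hrα
  refine ⟨(r : K), hrmemO, ?_, ?_, ?_, ?_⟩
  · -- a unit of `O`: its residue `ab ≠ 0`
    have hle : O.valuation (r : K) ≤ 1 := (O.valuation_le_one_iff _).mpr hrmemO
    refine le_antisymm hle (not_lt.mp fun hlt => hab0 ?_)
    rw [← hres, residue_eq_zero_iff, ValuationSubring.valuation_lt_one_iff]
    exact hlt
  · rw [hres]
    exact habtop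
  · -- the minimal polynomial over `F` is that over the integrally closed `A`
    intro i
    have hint : IsIntegral A (r : K) := r.2
    rw [minpoly.isIntegrallyClosed_eq_field_fractions' F hint, Polynomial.coeff_map]
    exact ((minpoly A (r : K)).coeff i).2
  · intro W hW hWO
    have hWs : W ∈ s := (hs W).mpr hW
    have := hrW ⟨W, hWs⟩ (fun h => hWO (congrArg Subtype.val h))
    exact (hmem𝔫 ⟨W, hWs⟩ r).mp this

end Generator

/-! ### `K = F(η)` -/

section AdjoinTop

variable {F K : Type u} [Field F] [Field K] [Algebra F K] [FiniteDimensional F K]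
  (O : ValuationSubring K)

/-- **`K = F(η)`.** With `η` as in `exists_unit_generator_mem_maximalIdeal` and `|F^×| = |K^×|`:
`O` is the only extension of `O ∩ F(η)` to `K` (`η` is a unit of `O` and lies in the maximal
ideal of every other extension of `O ∩ F`), `e(O/F(η)) = f(O/F(η)) = 1` (the residue of `η`
generates the residue field), and `F(η)` is a defectless field, so `[K : F(η)] = e f = 1`.
[folklore] -/
theorem adjoin_simple_eq_top_of_isDefectlessField
    (hdef : IsDefectlessField F (O.comap (algebraMap F K))) (hE : valueSubgroup F O = ⊤)
    {η : K} (hη : η ∈ O) (hη1 : O.valuation η = 1)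
    (hgen : IntermediateField.adjoin (residueSubfield F O) {residue O ⟨η, hη⟩} = ⊤)
    (hother : ∀ W : ValuationSubring K, W.comap (algebraMap F K) = O.comap (algebraMap F K) →
      W ≠ O → W.valuation η < 1) :
    F⟮η⟯ = ⊤ := by
  classical
  set E := F⟮η⟯ with hEdef
  set OE := O.comap (algebraMap E K) with hOE
  have hEF : OE.comap (algebraMap F E) = O.comap (algebraMap F K) := by
    rw [hOE, ValuationSubring.comap_comap, ← IsScalarTower.algebraMap_eq]
  have hdefE : IsDefectlessField E OE :=
    IsDefectlessField.finiteDimensional (K := F) OE (by rw [hEF]; exact hdef)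
  obtain ⟨s, hs, hsum⟩ := hdefE K inferInstance
  let ηE : E := ⟨η, IntermediateField.mem_adjoin_simple_self F η⟩
  have hηE : algebraMap E K ηE = η := rfl
  have hη0 : η ≠ 0 := fun h => by
    rw [h, map_zero] at hη1
    exact zero_ne_one hη1
  -- `O` is the only extension of `OE` to `K`
  have hsO : s = {O} := by
    ext W
    rw [hs, Finset.mem_singleton]
    constructor
    · intro hW
      by_contra hWO
      have hWF : W.comap (algebraMap F K) = O.comap (algebraMap F K) := by
        rw [IsScalarTower.algebraMap_eq F E K, ← ValuationSubring.comap_comap, hW]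
        exact hEF
      have hlt := hother W hWF hWO
      have hinvO : η⁻¹ ∈ O := by
        rw [← O.valuation_le_one_iff, map_inv₀, hη1, inv_one]
      have hinvE : ηE⁻¹ ∈ OE := by
        show algebraMap E K ηE⁻¹ ∈ O
        rw [map_inv₀, hηE]
        exact hinvO
      rw [← hW] at hinvE
      have hinvW : η⁻¹ ∈ W := by
        have : algebraMap E K ηE⁻¹ ∈ W := hinvE
        rw [map_inv₀, hηE] at this
        exact this
      have h1 : W.valuation η⁻¹ ≤ 1 := (W.valuation_le_one_iff _).mpr hinvW
      rw [map_inv₀, inv_le_one₀ ((Valuation.pos_iff _).mpr hη0)] at h1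
      exact (not_lt.mpr h1) hlt
    · rintro rfl
      rw [hOE]
  -- `e = f = 1`
  have he : ramificationIndex E O = 1 := ramificationIndex_eq_one_of_valueSubgroup_eq_top F O hE
  have hf : inertiaDegree E O = 1 := by
    unfold inertiaDegree
    have hle := residueSubfield_le_residueSubfield F E O
    have hηres : residue O ⟨η, hη⟩ ∈ residueSubfield E O := residue_mem_residueSubfield E O ηE hη
    let T : IntermediateField (residueSubfield F O) (ResidueField O) :=
      (residueSubfield E O).toIntermediateField fun x => hle x.2
    have hT : (⊤ : IntermediateField (residueSubfield F O) (ResidueField O)) ≤ T := by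
      rw [← hgen]
      exact IntermediateField.adjoin_le_iff.mpr (Set.singleton_subset_iff.mpr hηres)
    have htop : residueSubfield E O = ⊤ :=
      eq_top_iff.mpr fun r _ => hT (IntermediateField.mem_top (x := r))
    rw [htop]
    exact finrank_top_subfield_eq_one _
  rw [hsO, Finset.sum_singleton, he, hf, mul_one] at hsum
  refine IntermediateField.eq_of_le_of_finrank_eq' le_top ?_
  rw [← hsum, IntermediateField.finrank_top]

end AdjoinTop

end Literature.AlgebraicGeometry.Resolution

end
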